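import Summits.KontsevichZagierPeriods.KontsevichZagierPeriods.Theses.AyoubSpecialisation
import Summits.KontsevichZagierPeriods.KontsevichZagierPeriods.Theorems.TerasomaMultiplicationBetaCancellationOfAyoubPiCancellation
import Summits.KontsevichZagierPeriods.KontsevichZagierPeriods.Theorems.TerasomaMultiplicationBetaCancellationStubSlabDescent
import Summits.KontsevichZagierPeriods.KontsevichZagierPeriods.Theorems.TerasomaMultiplicationBetaCancellationStubTriangleConst
import Summits.KontsevichZagierPeriods.KontsevichZagierPeriods.Theorems.TerasomaMultiplicationBetaCancellationStubArchimedesTriangle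
import Summits.KontsevichZagierPeriods.KontsevichZagierPeriods.Theorems.TerasomaMultiplicationBetaCancellationStubPiMulFibred

/-!
# `π`-cancellation for FIBRED certificates, and the crux as "fibred reduction"

Assembly file of the crux lead (seat c7, `--supports` stmt-KontsevichZagierPeriods-13633, line
`dirichlet-companion-to-pi`). Item 0540 (`AyoubPiCancellation`: for the pinned disc family
`P n r = [unit disc in coordinates 0,1] × r`, `lift (of ∘ P) c ∈ relations → c ∈ relations`) is
PROVED here for every certificate lying in `KZ.fibredRelations` — the subgroup generated by all
additivity moves, the changes of variables preserving the first coordinate (`Φ z 0 = z 0`) and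
the Newton–Leibniz moves over a base of dimension `≥ 1` (Ayoub's "rules relative to a base", the
base being the first disc coordinate `x`):

  `fibred_ayoubPiCancellation : lift (of ∘ P) c ∈ fibredRelations → c ∈ relations`.

Proof (four landed stubs): slab restriction `{a < x < b}` preserves fibred relations
(`KZ.slabMap_mem_fibredRelations`), so `[D ∩ {x < -1/2}]·c` and `[D ∩ {x > -1/2}]·c` are relations
SEPARATELY (`stub_slabDescent`); by ARCHIMEDES' TRISECTION `D ∩ {x > -1/2}` is the inscribed
equilateral triangle `T` plus the two rotations by `∓2π/3` (real-algebraic rule-(2) moves) of the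
segment `D ∩ {x < -1/2}` (`stub_archimedesOfTriangle`), so `[T]·c ∈ relations`; `T` is worth the
algebraic constant `3√3/4` (`stub_triangleConst`, two Newton–Leibniz moves), so
`scale (3√3/4) c ∈ relations` and `c ∈ relations` (`scale_mem_relations_iff`). No slicing at a
point and no o-minimal integrability locus is used.

Consequently the crux `BetaCancellation` (≡ item 0540 by `betaCancellation_iff_ayoubPiCancellation`)
is EQUIVALENT to FIBRED REDUCTION — "every relation among disc multiples is a fibred relation"
(`betaCancellation_iff_fibredReduction`; the converse inclusion `[π]·relations ⊆ fibredRelations`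
is `stub_piMulFibred`). This localises the open problem (Huber–Wüstholz 2022, App. A.4) in the
rule-(2) moves that move the first disc coordinate.
-/

noncomputable section

-- `Summit.KontsevichZagierPeriods.KontsevichZagierPeriods.…` is the tree's mandated layout (single-conjunct summit).
set_option linter.dupNamespace false

namespace Summit.KontsevichZagierPeriods.KontsevichZagierPeriods.BetaCancellationLine

open Set MeasureTheory
open Literature.NumberTheory.Transcendental
open Literature.NumberTheory.Transcendental.KZ
open Summit.KontsevichZagierPeriods.KontsevichZagierPeriods.BetaCancellationNegative (volume_setOf_apply_eq_zero)

/-- **`π`-CANCELLATION FOR FIBRED CERTIFICATES** (item 0540 restricted to `KZ.fibredRelations`,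
unconditional): for every pinned disc family `P` and every formal combination `c`, if
`lift (of ∘ P) c` is a fibred relation then `c` is a relation. [folklore] -/
theorem fibred_ayoubPiCancellation :
    ∀ (P : ∀ n : ℕ, IntegralRep n → IntegralRep (n + 2)),
      (∀ (n : ℕ) (r : IntegralRep n), (P n r).domain = {z : Fin (n + 2) → ℝ | z 0 ^ 2 + z 1 ^ 2 ≤ 1 ∧ (fun i : Fin n => z i.succ.succ) ∈ r.domain} ∧ (P n r).integrand = fun z => r.integrand (fun i : Fin n => z i.succ.succ)) →
      ∀ c : FormalRep,
        FreeAbelianGroup.lift (fun s : (Σ n, IntegralRep n) => of (P s.1 s.2)) c ∈ fibredRelations →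
        c ∈ relations :=
  fun P hP c hc =>
    stub_archimedesOfTriangle stub_triangleConst c (stub_slabDescent P hP c (-2) (-1/2) hc)
      (stub_slabDescent P hP c (-1/2) 2 hc)

/-- **Item 0540 ⟺ FIBRED REDUCTION**: `AyoubPiCancellation` holds iff every relation among disc
multiples `lift (of ∘ P) c` is a fibred relation. [folklore] -/
theorem ayoubPiCancellation_iff_fibredReduction :
    Summit.KontsevichZagierPeriods.KontsevichZagierPeriods.Theses.AyoubSpecialisation.AyoubPiCancellation ↔
    ∀ (P : ∀ n : ℕ, IntegralRep n → IntegralRep (n + 2)),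
      (∀ (n : ℕ) (r : IntegralRep n), (P n r).domain = {z : Fin (n + 2) → ℝ | z 0 ^ 2 + z 1 ^ 2 ≤ 1 ∧ (fun i : Fin n => z i.succ.succ) ∈ r.domain} ∧ (P n r).integrand = fun z => r.integrand (fun i : Fin n => z i.succ.succ)) →
      ∀ c : FormalRep,
        FreeAbelianGroup.lift (fun s : (Σ n, IntegralRep n) => of (P s.1 s.2)) c ∈ relations →
        FreeAbelianGroup.lift (fun s : (Σ n, IntegralRep n) => of (P s.1 s.2)) c ∈ fibredRelations := by
  constructor
  · intro h P hP c hc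
    exact stub_piMulFibred P hP c (h P hP c hc)
  · intro h P hP c hc
    exact fibred_ayoubPiCancellation P hP c (h P hP c hc)

/-- **`KZ.PiCancellation` ⟺ FIBRED REDUCTION** (through `stub_ayoubBridge`). [folklore] -/
theorem piCancellation_iff_fibredReduction :
    Literature.NumberTheory.Transcendental.KZ.PiCancellation ↔
    ∀ (P : ∀ n : ℕ, IntegralRep n → IntegralRep (n + 2)),
      (∀ (n : ℕ) (r : IntegralRep n), (P n r).domain = {z : Fin (n + 2) → ℝ | z 0 ^ 2 + z 1 ^ 2 ≤ 1 ∧ (fun i : Fin n => z i.succ.succ) ∈ r.domain} ∧ (P n r).integrand = fun z => r.integrand (fun i : Fin n => z i.succ.succ)) →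
      ∀ c : FormalRep,
        FreeAbelianGroup.lift (fun s : (Σ n, IntegralRep n) => of (P s.1 s.2)) c ∈ relations →
        FreeAbelianGroup.lift (fun s : (Σ n, IntegralRep n) => of (P s.1 s.2)) c ∈ fibredRelations :=
  stub_ayoubBridge.symm.trans ayoubPiCancellation_iff_fibredReduction

/-- **THE CRUX ⟺ FIBRED REDUCTION**: `BetaCancellation` (stmt-13633) holds iff every relation
among disc multiples is a fibred relation — the open core isolated by seat c7. [folklore] -/
theorem betaCancellation_iff_fibredReduction :
    Summit.KontsevichZagierPeriods.KontsevichZagierPeriods.Theses.TerasomaMultiplication.BetaCancellation ↔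
    ∀ (P : ∀ n : ℕ, IntegralRep n → IntegralRep (n + 2)),
      (∀ (n : ℕ) (r : IntegralRep n), (P n r).domain = {z : Fin (n + 2) → ℝ | z 0 ^ 2 + z 1 ^ 2 ≤ 1 ∧ (fun i : Fin n => z i.succ.succ) ∈ r.domain} ∧ (P n r).integrand = fun z => r.integrand (fun i : Fin n => z i.succ.succ)) →
      ∀ c : FormalRep,
        FreeAbelianGroup.lift (fun s : (Σ n, IntegralRep n) => of (P s.1 s.2)) c ∈ relations →
        FreeAbelianGroup.lift (fun s : (Σ n, IntegralRep n) => of (P s.1 s.2)) c ∈ fibredRelations :=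
  betaCancellation_iff_ayoubPiCancellation.trans ayoubPiCancellation_iff_fibredReduction

/-- **The crux from fibred reduction** (closing term the day the open core lands). [folklore] -/
theorem betaCancellation_of_fibredReduction
    (h : ∀ (P : ∀ n : ℕ, IntegralRep n → IntegralRep (n + 2)),
      (∀ (n : ℕ) (r : IntegralRep n), (P n r).domain = {z : Fin (n + 2) → ℝ | z 0 ^ 2 + z 1 ^ 2 ≤ 1 ∧ (fun i : Fin n => z i.succ.succ) ∈ r.domain} ∧ (P n r).integrand = fun z => r.integrand (fun i : Fin n => z i.succ.succ)) →
      ∀ c : FormalRep,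
        FreeAbelianGroup.lift (fun s : (Σ n, IntegralRep n) => of (P s.1 s.2)) c ∈ relations →
        FreeAbelianGroup.lift (fun s : (Σ n, IntegralRep n) => of (P s.1 s.2)) c ∈ fibredRelations) :
    Summit.KontsevichZagierPeriods.KontsevichZagierPeriods.Theses.TerasomaMultiplication.BetaCancellation :=
  betaCancellation_iff_fibredReduction.2 h


/-! ## One segment suffices: `0540 ⟺ [π]·c ∈ relations → [S_A]·c ∈ relations` -/

/-- **The disc is its two slab pieces**: `[D] − [D ∩ {x < -1/2}] − [D ∩ {x > -1/2}] ∈ relations`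
(cutting at the rational parameter value `x = -1/2`; the chord is null). [folklore] -/
theorem of_piRep_sub_of_slabs_mem_relations :
    of piRep - of (piRep.slabRestrict (-2) (-1/2)) - of (piRep.slabRestrict (-1/2) 2) ∈ relations := by
  -- cut `[π]` at the slab `{-1/2 < x < 2}`
  have h1 := domainAddRel_subset_relations
    (IntegralRep.of_sub_of_slabRestrict_sub_of_slabCompl_mem piRep (-1/2) 2)
  -- the complement `D ∩ {x ≤ -1/2}` is the segment `D ∩ {-2 < x < -1/2}` up to the null chord
  have hsub : (piRep.slabRestrict (-2) (-1/2)).domain ⊆ (piRep.slabCompl (-1/2) 2).domain := by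
    intro z hz
    rw [mem_segA_domain] at hz
    rw [IntegralRep.domain_slabCompl]
    refine ⟨?_, fun h => ?_⟩
    · rw [piRep_domain, mem_piDisc]; exact hz.1
    · rw [mem_paramSlab] at h
      push_cast at h
      linarith [hz.2.2, h.1]
  have hvol : volume ((piRep.slabCompl (-1/2) 2).domain \ (piRep.slabRestrict (-2) (-1/2)).domain) = 0 := by
    refine measure_mono_null (fun z hz => ?_) (volume_setOf_apply_eq_zero (0 : Fin 2) (-(1/2)))
    obtain ⟨hz1, hz2⟩ := hz
    rw [IntegralRep.domain_slabCompl] at hz1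
    obtain ⟨hd, hc⟩ := hz1
    rw [piRep_domain, mem_piDisc] at hd
    rw [mem_paramSlab] at hc
    push_cast at hc
    have hle : z 0 ≤ 1 := by nlinarith [sq_nonneg (z 1), sq_nonneg (z 0 - 1)]
    have hge : -1 ≤ z 0 := by nlinarith [sq_nonneg (z 1), sq_nonneg (z 0 + 1)]
    have h1' : z 0 ≤ -(1/2) := by
      by_contra h
      push Not at h
      exact hc ⟨by linarith, by linarith⟩
    have h2' : -(1/2) ≤ z 0 := by
      by_contra h
      push Not at h
      exact hz2 ((mem_segA_domain z).2 ⟨hd, by linarith, h⟩)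
    show z 0 = -(1/2)
    exact le_antisymm h1' h2'
  have h2 := (piRep.slabCompl (-1/2) 2).of_sub_of_restrict_mem_relations
    (piRep.slabRestrict (-2) (-1/2)).isSemialgebraic_domain hsub hvol
  have e : (piRep.slabCompl (-1/2) 2).restrict (piRep.slabRestrict (-2) (-1/2)).domain
      (piRep.slabRestrict (-2) (-1/2)).isSemialgebraic_domain hsub = piRep.slabRestrict (-2) (-1/2) :=
    IntegralRep.ext' rfl rfl
  rw [e] at h2
  have e2 : of piRep - of (piRep.slabRestrict (-2) (-1/2)) - of (piRep.slabRestrict (-1/2) 2) =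
      (of piRep - of (piRep.slabRestrict (-1/2) 2) - of (piRep.slabCompl (-1/2) 2)) +
        (of (piRep.slabCompl (-1/2) 2) - of (piRep.slabRestrict (-2) (-1/2))) := by abel
  rw [e2]
  exact relations.add_mem h1 h2

/-- **ONE SEGMENT SUFFICES**: `KZ.PiCancellation` holds iff the `120°`-segment `S_A = D ∩ {x < -1/2}`
kills (modulo relations) everything the disc kills — `[π]·c ∈ relations → [S_A]·c ∈ relations`.
[folklore] -/
theorem piCancellation_iff_segmentDescent :
    Literature.NumberTheory.Transcendental.KZ.PiCancellation ↔
      ∀ c : FormalRep, of piRep * c ∈ relations → of (piRep.slabRestrict (-2) (-1/2)) * c ∈ relations := by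
  constructor
  · intro h c hc
    exact mul_mem_relations_left_holds c _ (h c hc)
  · intro h c hc
    have hA := h c hc
    have hX := mul_mem_relations_right_holds _ c of_piRep_sub_of_slabs_mem_relations
    have hD : of (piRep.slabRestrict (-1/2) 2) * c ∈ relations := by
      have e : of (piRep.slabRestrict (-1/2) 2) * c =
          of piRep * c - of (piRep.slabRestrict (-2) (-1/2)) * c -
            (of piRep - of (piRep.slabRestrict (-2) (-1/2)) - of (piRep.slabRestrict (-1/2) 2)) * c := by
        simp only [sub_mul]; abel
      rw [e]
      exact relations.sub_mem (relations.sub_mem hc hA) hX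
    exact stub_archimedesOfTriangle stub_triangleConst c hA hD

/-- **The crux ⟺ one-segment descent.** [folklore] -/
theorem betaCancellation_iff_segmentDescent :
    Summit.KontsevichZagierPeriods.KontsevichZagierPeriods.Theses.TerasomaMultiplication.BetaCancellation ↔
      ∀ c : FormalRep, of piRep * c ∈ relations → of (piRep.slabRestrict (-2) (-1/2)) * c ∈ relations :=
  betaCancellation_iff_piCancellation.trans piCancellation_iff_segmentDescent

end Summit.KontsevichZagierPeriods.KontsevichZagierPeriods.BetaCancellationLine
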